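import Literature.MathematicalPhysics.QuantumFieldTheory.Balaban1983to89.B9CoReadingCoordsHolderAdm
import Literature.MathematicalPhysics.QuantumFieldTheory.Balaban1983to89.B9CoReadingCoordsHHolder
import Literature.MathematicalPhysics.QuantumFieldTheory.Balaban1983to89.B9CoReadingCoordsInput

/-!
# `Balaban1983to89.B9CoReadingCoordsHolderAdmReadings` — THE H-HÖLDER ((3.133)) AND INPUT ((3.44)–(3.45)) CO-READINGS OF THE N06 CERTIFICATE AT THE `Adm`-CUT
# PIN CARRIER `holderProbesKA`: the twins of n06-l's `B9CoReadingCoordsHHolder` and n06-d's `B9CoReadingCoordsInput` (both routed through the product rule), so that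
# an edition re-pinning `h𝔭A : 𝔭A x = holderProbesKA …` keeps all three of its probe co-readings (`hH1A ∕ hH1N`, `hHCN`, `hIRA ∕ hIF`) as one-line `have`s

T. Bałaban, *Propagators for lattice gauge theories in a background field*, Commun. Math. Phys. **99** (1985) 389–434
[`Balaban1985BackgroundPropagators`, "B9"]; [4] = T. Bałaban, *Propagators and renormalization transformations for lattice gauge theories. II*, Commun. Math.
Phys. **96** (1984) 223–250 [`Balaban1984PropagatorsII`].

statement-level skeleton of published theorems with citation tags; proofs where landed; nothing here is a claim about the Yang–Mills mass gap

THE PRINT.  (3.40) p. 397 («sup_{x,x′:|x−x′|≦1}»: the Hölder quotient over the near pairs only); (3.133) p. 422 (third member `‖ζ∇H(·,y′)‖_β`); (3.44)–(3.45) p. 398.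

WHY THIS FILE (seat `pub-ymgap-dag-n06-w6`, supplier offer to the pin owner dag-n06-d; sequel of `B9CoReadingCoordsHolderAdm`).  The certificate of record (ed. 27
`…V6EPairNH` l.269–284) instantiates THREE co-reading families at the pin `𝔭A`: `bond_h1ReadsNbr_of_pins` (twin in the prequel), `bond_coReadsHHolderNbr_of_pins` and
`bond_inputReadsFam_of_pins`; the last two reach the probes only through n06-d's product rule `holderQB_le_of_probes`, so their twins at the cut carrier are the same proofs
with `holderQB_le_of_probesA`.
* §1 ★ `holderQB_deltaY_le_of_probesA` — n06-l's sampling reduction for MIXED families (coarse input `δ_{y′} ⊗ E`), at the cut weight.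
* §2 ★★ `coReadsHHolderNbr_hKernel_coordsA`, ★ `bond_coReadsHHolderNbr_of_pinsA` — `CoReadsHHolderNbr (hKernelOfOp …) U₁ (d+1) (holderProbesKA …) r (blkHK i) (DcoK ∘ₗ HcoK)`.
* §3 ★★ `inputReadsFam_kernelFamilyB_coordsA`, ★ `bond_inputReadsFam_of_pinsA` — `InputReadsFam (kernelFamilyB …) U₁ (bHK …) r … (β ↦ sliceProbe ((holderProbesKA …).ΦX U₁ β)) …`.

HONEST SCOPE.  Verbatim re-proofs of landed co-reading theorems at a sibling pin carrier; nothing of [B9] or [4] asserted; no edition written; COUNT-NEUTRAL; N06 NOT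
discharged; one finite 𝕋^{d+1} programme at fixed ε — nothing continuum, nothing about the mass gap.  Cell `pub-ymgap` (HUMAN RULING D-0062), Track A node N06 [B9],
seat `pub-ymgap-dag-n06-w6` (g0), 2026-08-28; a NEW file.
-/

noncomputable section

namespace Literature.MathematicalPhysics.QuantumFieldTheory.Balaban1983to89.B9CoReadingCoordsHolderAdmReadings

open B6GlobalChartV1 (PV blkV1)
open B6Geom246MultiLevelTorus (geomT)
open B6Ineq2142KLevelV1 (β)
open B6KLevelCensusIndexV1 (KIdx kGeo)
open B9GeoNormsKLevelV1 (geo9K geo9K_cutH_nonneg geo9K_supNorm_nonneg geo9K_holder_nonneg)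
open B9Thm34Ext (toB6)
open B11SectG (BlockNorm)
open B9CoRealizesRelAtLetters (RelB)
open B9Thm39ReadingCoords (cR39)
open B9CoReadingCoords (evDiagK coordOpK coordOpK_evDiagK cdBₗ cdBₗ_apply cdsBₗ XBK evBK blkBK GcoK DcoK off_bound_evBK)
open B9CoReadingCoordsH (coordOpKH coordOpKH_evDiagK XHK blkHK indY liftY_indY HcoK DcoK_comp_HcoK vol_inv_nonneg mul_vol_inv_eq evDiagK_indY_test)
open B9CoReadingCoordsHolder (PK blkPK probeK wK w₀K wnorm_le_of_coords)
open B9CoReadingCoordsHolderAdm (wKA holderProbesKA holderQB_le_of_probesA)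
open B9CoReadingCoordsInput (bHK supK holK pairMemberK_eq supK_evDiagK_le holK_evDiagK_le)
open B9RWSums343Holder (HolderProbes)
open B9RWSums344InputFam (InputReadsFam sliceProbe)
open B9RWSums346SecondDiff (familyOp)
open B9Thm312WholeHHolderNbr (CoReadsHHolderNbr)
open B6Cor28PrintedKLevelV1 (vol)
open Node00 (FBondY IBondY CfgY BallY liftY liftY_apply deltaY holderQB hKernelOfOp kernelFamilyB BondOpY BondParY cdB cdsB supInB iSup_ball_le)

variable {d ℓ : ℕ} {hd : 1 ≤ d + 1} {hL : Odd (ℓ + 1) ∧ 1 < ℓ + 1} {b₀ b₁ : ℝ}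
variable {𝔸 : Type} [NormedRing 𝔸] [NormedAlgebra ℂ 𝔸]
variable {κ : Type} [Fintype κ] [DecidableEq κ]

/-! ## §1 ★ The product rule for a MIXED family at a coarse delta input, at the cut weight -/

section Mixed

variable [CompleteSpace 𝔸] (i : KIdx d ℓ hd hL b₀ b₁) (b : Module.Basis κ ℝ 𝔸) [FiniteDimensional ℝ 𝔸]
variable {bI : FBondY i → IBondY i}

/-- ★ n06-l's `holderQB_deltaY_le_of_probes` (sampling reduction of a mixed family `T ν : (IBondY i → 𝔸) →ₗ (FBondY i → 𝔸)` at `δ_{y′} ⊗ E` to a bond→bond family) WITH THE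
HYPOTHESIS ON THE CUT PAIR WEIGHT `wKA`; proof verbatim with `holderQB_le_of_probesA`.
[cite: Balaban1985BackgroundPropagators, (3.40) p.397 + (3.133) p.422 (third member); Balaban1984PropagatorsII, (2.51)–(2.52) p.232 + (2.137) p.247] -/
theorem holderQB_deltaY_le_of_probesA
    (hβ1 : ∀ x : FBondY i, (geomT i.D).dist (β i.hN i.D i.hk (bI x)) (blkV1 i.hN i.D x) ≤ 1) {r : ℝ} (hr : 2 ≤ r)
    (par : BondParY 𝔸 i) (U : CfgY 𝔸 i) (T : Fin (d + 1) → (IBondY i → 𝔸) →ₗ[ℝ] (FBondY i → 𝔸)) (y' : IBondY i) (α : ℝ) (z : FBondY i → ℝ)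
    (y : IBondY i) {c : ℝ} (hc : 0 ≤ c)
    (hcut : ∀ f, z f ≠ 0 → (geomT i.D).dist (blkV1 i.hN i.D f) (β i.hN i.D i.hk y) ≤ 1)
    (hP : ∀ p : PK (FBondY i) (Fin (d + 1)) κ, (geomT i.D).dist (β i.hN i.D i.hk (blkPK bI p)) (β i.hN i.D i.hk y) ≤ r →
      |probeK b (fun x x' : FBondY i => par U x.src x'.src) (wKA i α) (w₀K i α) ((cR39 b • coordOpKH b T) (evDiagK (indY i y'))) p| ≤ c)
    (E : BallY 𝔸) (ν : Fin (d + 1)) :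
    holderQB i (par U) α z (T ν (deltaY y' (E : 𝔸))) ≤ c * (kGeo i).cutH α z := by
  classical
  have h0 : 0 ≤ c * (kGeo i).cutH α z := mul_nonneg hc (geo9K_cutH_nonneg i α (Sum.inr z))
  rcases isEmpty_or_nonempty (FBondY i) with hemp | ⟨⟨x₀⟩⟩
  · have hq : holderQB i (par U) α z (T ν (deltaY y' (E : 𝔸))) = 0 := by
      unfold holderQB
      exact Real.iSup_of_isEmpty _
    rw [hq]
    exact h0
  · set J₀ : FBondY i → ℝ := fun f => if f = x₀ then 1 else 0 with hJ₀
    set P : (FBondY i → 𝔸) →ₗ[ℝ] (IBondY i → 𝔸) :=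
      LinearMap.pi (fun cc : IBondY i => (indY i y' cc) • (LinearMap.proj x₀ : (FBondY i → 𝔸) →ₗ[ℝ] 𝔸)) with hPdef
    have hPJ : ∀ E' : 𝔸, P (liftY J₀ E') = deltaY y' E' := by
      intro E'
      rw [← liftY_indY i y' E']
      funext cc
      rw [hPdef, LinearMap.pi_apply, LinearMap.smul_apply, LinearMap.proj_apply, liftY_apply, liftY_apply, hJ₀]
      simp only [if_true, Complex.ofReal_one, one_smul]
      exact (Complex.coe_smul (indY i y' cc) E').symm
    set T'' : Fin (d + 1) → (FBondY i → 𝔸) →ₗ[ℝ] (FBondY i → 𝔸) := fun μ => T μ ∘ₗ P with hT''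
    have hTJ : ∀ (μ : Fin (d + 1)) (E' : 𝔸), T'' μ (liftY J₀ E') = T μ (deltaY y' E') := fun μ E' => by
      rw [hT'', LinearMap.comp_apply, hPJ]
    have hvec : (cR39 b • coordOpK b T'') (evDiagK J₀) = (cR39 b • coordOpKH b T) (evDiagK (indY i y')) := by
      funext p
      simp only [LinearMap.smul_apply, Pi.smul_apply, coordOpK_evDiagK, coordOpKH_evDiagK, hTJ, liftY_indY]
    have key := holderQB_le_of_probesA i b hβ1 hr (par U) T'' J₀ α z y hc hcut (fun p hp => by rw [hvec]; exact hP p hp) E ν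
    rwa [hTJ] at key

end Mixed

/-! ## §2 ★★ The H-Hölder co-reading at the cut carrier -/

section CoReading

variable [CompleteSpace 𝔸] [FiniteDimensional ℝ 𝔸] (i : KIdx d ℓ hd hL b₀ b₁) (b : Module.Basis κ ℝ 𝔸)
variable (B : B9.Backgrounds) (cfg : B.Cfg → CfgY 𝔸 i) (O : CfgY 𝔸 i → (IBondY i → 𝔸) →ₗ[ℂ] (FBondY i → 𝔸)) (par : BondParY 𝔸 i) (U₁ : B.Cfg)
variable {bI : FBondY i → IBondY i}

/-- ★★ **`CoReadsHHolderNbr (hKernelOfOp i B cfg O par) U₁ (d+1) (holderProbesKA i b B cfg par bI) r (blkHK i) (DcoK … U₁ ∘ₗ HcoK … O U₁)`** for EVERY H-letter `O`, EVERY `U₁`,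
every real basis, every `r ≥ 2`, `bI` 1-faithful — n06-l's `coReadsHHolderNbr_hKernel_coords` at the cut carrier.
[cite: Balaban1985BackgroundPropagators, (3.133) p.422 (third member) + (3.40) p.397 + (3.126) p.420; Balaban1984PropagatorsII, (2.150) p.249, (2.51)–(2.52) p.232] -/
theorem coReadsHHolderNbr_hKernel_coordsA [Fintype (geo9K i).Site]
    (hβ1 : ∀ x : FBondY i, (geomT i.D).dist (β i.hN i.D i.hk (bI x)) (blkV1 i.hN i.D x) ≤ 1) {r : ℝ} (hr : 2 ≤ r) :
    CoReadsHHolderNbr (hKernelOfOp i B cfg O par) U₁ (d + 1) (holderProbesKA i b B cfg par bI) r (blkHK (κ := κ) i)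
      (DcoK i b B cfg U₁ ∘ₗ HcoK i b B cfg O U₁) := by
  refine ⟨fun α ζ => geo9K_cutH_nonneg i α ζ, ?_⟩
  intro α ζ y y' c hc hcut hb
  have h0 : 0 ≤ c * (geo9K i).cutH α ζ := mul_nonneg hc (geo9K_cutH_nonneg i α ζ)
  cases ζ with
  | inl zz => exact h0
  | inr zz =>
      have hC : 0 ≤ c * (geo9K i).len y' ^ (((d + 1 : ℕ) : ℝ)) :=
        mul_nonneg hc (Real.rpow_nonneg (B6KLevelCensusIndexV1.len_pos i y').le _)
      have hPY := hb _ (evDiagK_indY_test i y').1 (evDiagK_indY_test i y').2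
      rw [DcoK_comp_HcoK] at hPY
      show (⨆ E : BallY 𝔸, ⨆ ν : Fin (d + 1),
          holderQB i (par (cfg U₁)) α zz (cdB i (cfg U₁) ν (O (cfg U₁) (deltaY y' (E : 𝔸)))) * (vol i y')⁻¹) ≤ c * (kGeo i).cutH α zz
      have h0' : 0 ≤ c * (kGeo i).cutH α zz := h0
      refine iSup_ball_le (fun E => Real.iSup_le (fun ν => ?_) h0') h0'
      have key := holderQB_deltaY_le_of_probesA i b hβ1 hr par (cfg U₁)
        (fun ν => cdBₗ i (cfg U₁) ν ∘ₗ (O (cfg U₁)).restrictScalars ℝ) y' α zz y hC hcut hPY E ν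
      have key' : holderQB i (par (cfg U₁)) α zz (cdB i (cfg U₁) ν (O (cfg U₁) (deltaY y' (E : 𝔸)))) ≤
          c * (geo9K i).len y' ^ (((d + 1 : ℕ) : ℝ)) * (kGeo i).cutH α zz := by
        simpa only [LinearMap.comp_apply, cdBₗ_apply, LinearMap.coe_restrictScalars] using key
      have hcut0 : 0 ≤ (kGeo i).cutH α zz := geo9K_cutH_nonneg i α (Sum.inr zz)
      calc holderQB i (par (cfg U₁)) α zz (cdB i (cfg U₁) ν (O (cfg U₁) (deltaY y' (E : 𝔸)))) * (vol i y')⁻¹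
          ≤ c * (geo9K i).len y' ^ (((d + 1 : ℕ) : ℝ)) * (kGeo i).cutH α zz * (vol i y')⁻¹ :=
            mul_le_mul_of_nonneg_right key' (vol_inv_nonneg i y')
        _ = c * (geo9K i).len y' ^ (((d + 1 : ℕ) : ℝ)) * (vol i y')⁻¹ * (kGeo i).cutH α zz := by ring
        _ = c * (kGeo i).cutH α zz := by rw [mul_vol_inv_eq i y' c]

/-- ★ **THE H-HÖLDER CO-READING AT THE CUT CARRIER UNDER THE PINS, RADIUS 2** (`𝔭 = holderProbesKA …`, `blkZ = blkHK`, `Hm = HcoK … O U₁`, `D = DcoK … U₁`) — the twin of n06-l's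
`bond_coReadsHHolderNbr_of_pins` (binder `hHCN`, letters `H`, `H₁`). [cite: Balaban1985BackgroundPropagators, (3.133) p.422 (third member) + (3.40) p.397; Balaban1984PropagatorsII, (2.150) p.249, (2.51)–(2.52) p.232] -/
theorem bond_coReadsHHolderNbr_of_pinsA [Fintype (geo9K i).Site]
    (hβ1 : ∀ x : FBondY i, (geomT i.D).dist (β i.hN i.D i.hk (bI x)) (blkV1 i.hN i.D x) ≤ 1)
    {𝔭 : HolderProbes (geo9K i) B (XBK κ i) (XBK κ i) (PK (FBondY i) (Fin (d + 1)) κ) (PK (FBondY i) (Fin (d + 1)) κ)}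
    {blkZ : XHK κ i → IBondY i} {Hm : (XHK κ i → ℝ) →ₗ[ℝ] (XBK κ i → ℝ)} {D : (XBK κ i → ℝ) →ₗ[ℝ] (XBK κ i → ℝ)}
    (h𝔭 : 𝔭 = holderProbesKA i b B cfg par bI) (hblkZ : blkZ = blkHK i) (hHm : Hm = HcoK i b B cfg O U₁) (hD : D = DcoK i b B cfg U₁) :
    CoReadsHHolderNbr (hKernelOfOp i B cfg O par) U₁ (d + 1) 𝔭 2 blkZ (D ∘ₗ Hm) := by
  subst h𝔭 hblkZ hHm hD
  exact coReadsHHolderNbr_hKernel_coordsA i b B cfg O par U₁ hβ1 le_rfl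

end CoReading

/-! ## §3 ★★ The input co-readings (3.44)∕(3.45) at the cut carrier -/

section Input

variable [CompleteSpace 𝔸] [FiniteDimensional ℝ 𝔸]
variable (i : KIdx d ℓ hd hL b₀ b₁) [Fintype (geo9K i).Site] [DecidableRel (RelB i)] (b : Module.Basis κ ℝ 𝔸)
variable (B : B9.Backgrounds) (cfg : B.Cfg → CfgY 𝔸 i) (O : BondOpY 𝔸 i) (par : BondParY 𝔸 i) (U₁ : B.Cfg)
variable {bI : FBondY i → IBondY i}

/-- ★★ **THE INPUT CO-READINGS OF `kernelFamilyB` ON THE PAIR-FAMILY COORDINATE MODEL WITH THE INPUT NORM `bHK`, PROBES OF THE CUT CARRIER** — n06-d's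
`inputReadsFam_kernelFamilyB_coords` with `holderProbesKA` (fields `isLoc ∕ loc_le ∕ hs_nonneg ∕ cutH_nonneg ∕ obs4` probe-free and verbatim; `obs5` through `holderQB_le_of_probesA`).
[cite: Balaban1985BackgroundPropagators, (3.44)–(3.45) p.398 + (3.39)–(3.41) p.397; Balaban1984PropagatorsII, (2.51)–(2.52) p.232 + (2.54) p.233 + (2.137) p.247] -/
theorem inputReadsFam_kernelFamilyB_coordsA
    (hβI : ∀ (x : FBondY i) (c : IBondY i), blkV1 i.hN i.D x = β i.hN i.D i.hk c → β i.hN i.D i.hk (bI x) = blkV1 i.hN i.D x)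
    (hβ1 : ∀ x : FBondY i, (geomT i.D).dist (β i.hN i.D i.hk (bI x)) (blkV1 i.hN i.D x) ≤ 1) {r : ℝ} (hr : 2 ≤ r) {R : ℝ} {H : Prop}
    {Dd Dds : Fin (d + 1) → ((XBK κ i → ℝ) →ₗ[ℝ] (XBK κ i → ℝ))}
    (hDd : Dd = fun μ => coordOpK b (fun _ : Fin (d + 1) => cdBₗ i (cfg U₁) μ))
    (hDds : Dds = fun μ => coordOpK b (fun _ : Fin (d + 1) => cdsBₗ i (cfg U₁) μ)) :
    InputReadsFam (R := R) (H := H) (kernelFamilyB i B cfg O par) U₁ (fun ε => bHK i bI ε) r (blkBK i bI ∘ Prod.fst)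
      (blkPK bI ∘ Prod.fst) (fun β => sliceProbe ((holderProbesKA i b B cfg par bI).ΦX U₁ β)) (evBK i)
      (familyOp fun q : Fin (d + 1) × Fin (d + 1) => Dd q.1 ∘ₗ (GcoK i b B cfg O U₁ ∘ₗ Dds q.2)) := by
  subst hDd hDds
  set T : Fin (d + 1) → Fin (d + 1) → (FBondY i → 𝔸) →ₗ[ℝ] (FBondY i → 𝔸) :=
    fun ν μ => cdBₗ i (cfg U₁) ν ∘ₗ ((O (cfg U₁)).restrictScalars ℝ ∘ₗ cdsBₗ i (cfg U₁) μ) with hT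
  have hmem : ∀ (ν μ : Fin (d + 1)) (F : XBK κ i → ℝ) (v : XBK κ i),
      (familyOp (fun q : Fin (d + 1) × Fin (d + 1) =>
        coordOpK b (fun _ : Fin (d + 1) => cdBₗ i (cfg U₁) q.1) ∘ₗ (GcoK i b B cfg O U₁ ∘ₗ coordOpK b (fun _ : Fin (d + 1) => cdsBₗ i (cfg U₁) q.2))) F)
          (v, (ν, μ)) = (cR39 b • coordOpK b (fun _ : Fin (d + 1) => T ν μ)) F v := by
    intro ν μ F v
    show (coordOpK b (fun _ : Fin (d + 1) => cdBₗ i (cfg U₁) ν) ∘ₗ (GcoK i b B cfg O U₁ ∘ₗ coordOpK b (fun _ : Fin (d + 1) => cdsBₗ i (cfg U₁) μ))) F v = _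
    rw [pairMemberK_eq]
  have hE' : ∀ E : BallY 𝔸, ‖(E : 𝔸)‖ ≤ 1 := fun E => mem_closedBall_zero_iff.1 E.2
  refine ⟨?_, ?_, ?_, ?_, ?_, ?_⟩
  · intro ε lam y' hs
    exact (off_bound_evBK (κ := κ) i hβI).1 lam y' hs
  · intro ε lam y' hs
    show supK i bI y' (evBK i lam) + holK i bI ε y' (evBK i lam) ≤ (geo9K i).holder ε lam + (geo9K i).supNorm lam
    cases lam with
    | inl f =>
        have h0 : evBK (κ := κ) i (Sum.inl f) = 0 := rfl
        have hl : supK i bI y' (evBK (κ := κ) i (Sum.inl f)) + holK i bI ε y' (evBK (κ := κ) i (Sum.inl f)) = 0 := by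
          rw [h0]; exact (bHK (R := R) (H := H) i bI ε).loc_zero y'
        rw [hl]; exact add_nonneg (geo9K_holder_nonneg i ε _) (geo9K_supNorm_nonneg i _)
    | inr J =>
        rw [add_comm]
        exact add_le_add (holK_evDiagK_le i hβI ε y' J hs) (supK_evDiagK_le i y' J)
  · intro ε lam
    exact add_nonneg (geo9K_holder_nonneg i ε lam) (geo9K_supNorm_nonneg i lam)
  · intro β' ζ
    exact geo9K_cutH_nonneg i β' ζ
  · intro lam y c hc hw
    cases lam with
    | inl f => exact hc
    | inr J =>
        show (⨆ E : BallY 𝔸, ⨆ ν : Fin (d + 1), ⨆ μ : Fin (d + 1),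
            supInB i (β i.hN i.D i.hk y) (cdB i (cfg U₁) ν (O (cfg U₁) (cdsB i (cfg U₁) μ (liftY J (E : 𝔸)))))) ≤ c
        refine iSup_ball_le (fun E => Real.iSup_le (fun ν => Real.iSup_le (fun μ => ?_) hc) hc) hc
        unfold supInB
        refine Real.iSup_le (fun x => ?_) hc
        have hnear : (geomT i.D).dist (β i.hN i.D i.hk (bI x.1)) (β i.hN i.D i.hk y) ≤ r := by
          have h1 := hβ1 x.1
          rw [x.2] at h1
          linarith
        have key := wnorm_le_of_coords b (T ν μ) J x.1 zero_le_one hc (fun cc cc' => ?_) (hE' E)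
        · rw [one_mul] at key
          exact key
        have h2 := hw ((x.1, ν, cc, cc'), (ν, μ)) hnear
        have hev : evBK (κ := κ) i (Sum.inr J) = evDiagK J := rfl
        rw [hmem, hev] at h2
        simp only [LinearMap.smul_apply, Pi.smul_apply, coordOpK_evDiagK, smul_eq_mul] at h2
        rw [one_mul]; exact h2
  · intro lam β' ζ y c hc hcut hP
    have h0 : 0 ≤ c * (geo9K i).cutH β' ζ := mul_nonneg hc (geo9K_cutH_nonneg i β' ζ)
    cases lam with
    | inl f => cases ζ with
      | inl zz => exact h0
      | inr zz => exact h0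
    | inr J => cases ζ with
      | inl zz => exact h0
      | inr zz =>
          show (⨆ E : BallY 𝔸, ⨆ ν : Fin (d + 1), ⨆ μ : Fin (d + 1),
              holderQB i (par (cfg U₁)) β' zz (cdB i (cfg U₁) ν (O (cfg U₁) (cdsB i (cfg U₁) μ (liftY J (E : 𝔸)))))) ≤ c * (kGeo i).cutH β' zz
          refine iSup_ball_le (fun E => Real.iSup_le (fun ν => Real.iSup_le (fun μ => ?_) h0) h0) h0
          exact holderQB_le_of_probesA i b hβ1 hr (par (cfg U₁)) (fun _ : Fin (d + 1) => T ν μ) J β' zz y hc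
            hcut (fun p hp => by
              have h2 := hP (p, (ν, μ)) hp
              have hsl : (fun v => (familyOp (fun q : Fin (d + 1) × Fin (d + 1) =>
                  coordOpK b (fun _ : Fin (d + 1) => cdBₗ i (cfg U₁) q.1) ∘ₗ (GcoK i b B cfg O U₁ ∘ₗ
                    coordOpK b (fun _ : Fin (d + 1) => cdsBₗ i (cfg U₁) q.2))) (evBK i (Sum.inr J))) (v, (ν, μ))) =
                  (cR39 b • coordOpK b (fun _ : Fin (d + 1) => T ν μ)) (evDiagK J) := by
                funext v; rw [hmem]; rfl
              rw [← hsl]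
              exact h2) E ν

/-- ★ **THE INPUT CO-READINGS AT THE CUT CARRIER UNDER THE PINS, RADIUS 2** (`𝔭 = holderProbesKA …`, `bH = bHK …`, `blk = blkBK bI`, `G = GcoK …`, `Dd ∕ Dds` pinned) — the twin of
n06-d's `bond_inputReadsFam_of_pins` (binders `hIRA` (row 19) and `hIF` (rows 20–21)). [cite: Balaban1985BackgroundPropagators, (3.44)–(3.45) p.398; Balaban1984PropagatorsII, (2.51)–(2.52) p.232] -/
theorem bond_inputReadsFam_of_pinsA
    (hβI : ∀ (x : FBondY i) (c : IBondY i), blkV1 i.hN i.D x = β i.hN i.D i.hk c → β i.hN i.D i.hk (bI x) = blkV1 i.hN i.D x)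
    (hβ1 : ∀ x : FBondY i, (geomT i.D).dist (β i.hN i.D i.hk (bI x)) (blkV1 i.hN i.D x) ≤ 1) {R : ℝ} {H : Prop}
    {𝔭 : HolderProbes (geo9K i) B (XBK κ i) (XBK κ i) (PK (FBondY i) (Fin (d + 1)) κ) (PK (FBondY i) (Fin (d + 1)) κ)}
    {bH : ℝ → BlockNorm (toB6 (geo9K i) R H) (XBK κ i → ℝ)} {blk : XBK κ i → IBondY i} {G : (XBK κ i → ℝ) →ₗ[ℝ] (XBK κ i → ℝ)}
    {Dd Dds : Fin (d + 1) → ((XBK κ i → ℝ) →ₗ[ℝ] (XBK κ i → ℝ))}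
    (h𝔭 : 𝔭 = holderProbesKA i b B cfg par bI) (hbH : bH = fun ε => bHK i bI ε) (hblk : blk = blkBK i bI) (hG : G = GcoK i b B cfg O U₁)
    (hDd : Dd = fun μ => coordOpK b (fun _ : Fin (d + 1) => cdBₗ i (cfg U₁) μ))
    (hDds : Dds = fun μ => coordOpK b (fun _ : Fin (d + 1) => cdsBₗ i (cfg U₁) μ)) :
    InputReadsFam (R := R) (H := H) (kernelFamilyB i B cfg O par) U₁ bH 2 (blk ∘ Prod.fst) (𝔭.blkPX ∘ Prod.fst) (fun β => sliceProbe (𝔭.ΦX U₁ β)) (evBK i)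
      (familyOp fun q : Fin (d + 1) × Fin (d + 1) => Dd q.1 ∘ₗ (G ∘ₗ Dds q.2)) := by
  subst h𝔭 hbH hblk hG
  exact inputReadsFam_kernelFamilyB_coordsA i b B cfg O par U₁ hβI hβ1 le_rfl hDd hDds

end Input

end Literature.MathematicalPhysics.QuantumFieldTheory.Balaban1983to89.B9CoReadingCoordsHolderAdmReadings

end
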